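import Summits.QuantumFields.QCD.Theorems.SmallFieldUltracontractivity.Negative.Tightness
import Summits.QuantumFields.QCD.Theorems.SpectralDefectExtinctionTipNoBindingFreeSymbol
import Summits.QuantumFields.QCD.Theorems.HeatSlicedQuarksDaviesGaffneyWilsonRange
import Literature.Barriers.QuantumFields.WilsonDeterminantMassSplitting

/-!
# Caloric fixed point — part D1: the smoothing row of the free parametrix
(helpers of the line lead for `stub_caloricFixedPoint`, crux `SmallFieldUltracontractivity`,
item stmt-QuantumFields-8871, line `point-centred-axial-parabolic`)

The perturbative term `T2a = ∫ row_x(K_σ M_χ D₁ᴴ E e^{-τH_U}) dτ` of the cut-off Duhamel parametrix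
moves the FREE difference operator `D₁ᴴ` onto the row of the cut-off free kernel `K_σ M_χ`.  Here we
bound the resulting row in `ℓ¹`:

  `Σ_k |(K M_χ D₁ᴴ)(i,k)| ≤ |m|·R₁ + 32·A + 512·R₁/N`,

where `R₁ = Σ_j |K(i,j)|` (row `ℓ¹` norm of `K`), `A = max_μ Σ_{z,b,β} |K(i,(z,b,β)) − K(i,(z+μ̂,b,β))|`
(summed nearest-neighbour column differences), `χ` is any site cutoff with values in `[0,1]` which is
`16/N`-Lipschitz under unit moves, and `D₁ = wilsonDirac ρ 1 m 1` is the free MASSIVE Wilson operator.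
The point is that `D₁ = m·1 + D₀` and the free massless `D₀` is a combination of first DIFFERENCES
(`wilsonDirac_one_mulVec_apply`), which land on `K χ`; `K` itself is arbitrary here.
-/

noncomputable section

namespace Summit.QuantumFields.QCD.Cruxes.SmallFieldUltracontractivity.PointCentredAxialParabolic

open Literature.MathematicalPhysics.QuantumLattice Literature.MathematicalPhysics.QuantumFieldTheory
open Literature.Probability.LatticeModels (TorusSite)
open Summit.QuantumFields.QCD.Theorems.SmallFieldUltracontractivity.Negative
open Summit.QuantumFields.QCD.Cruxes.TipNoBinding.PositivityNoLeakSpread (wilsonDirac_one_mulVec_apply)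
open Summit.QuantumFields.QCD.Theorems.HeatSlicedQuarksDaviesGaffney (norm_euclideanGamma_apply_le)
open scoped Matrix ComplexConjugate

variable {L : ℕ} [NeZero L]

/-! ### `X Dᴴ` rows as `D` applied to conjugated rows -/

/-- `(X Dᴴ)(i,k) = conj ((D *ᵥ conj(row_i X)) k)`. -/
theorem mul_conjTranspose_apply_eq_conj_mulVec {ι κ : Type*} [Fintype κ] (X : Matrix ι κ ℂ)
    (D : Matrix κ κ ℂ) (i : ι) (k : κ) :
    (X * Dᴴ) i k = conj ((D *ᵥ fun q => conj (X i q)) k) := by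
  rw [Matrix.mul_apply, Matrix.mulVec, dotProduct, map_sum]
  refine Finset.sum_congr rfl fun q _ => ?_
  rw [Matrix.conjTranspose_apply, map_mul, Complex.conj_conj, Complex.star_def, mul_comm]

/-! ### The free massive Wilson operator as mass plus first differences -/

omit [NeZero L] in
/-- The free massive Wilson operator is `m·1 + D₀`. -/
theorem wilsonDirac_freeCfg_eq_add_mass (m : ℝ) :
    wilsonDirac (fundamentalRep (Fin 3)) (freeCfg L) m 1 =
      wilsonDirac (fundamentalRep (Fin 3)) (1 : GaugeConfig 4 L SU3) 0 1 + ((m : ℝ) : ℂ) • 1 := by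
  have h := Literature.Barriers.QuantumFields.wilsonDirac_add_mass (fundamentalRep (Fin 3))
    (1 : GaugeConfig 4 L SU3) 0 m 1
  rw [zero_add] at h
  exact h

/-- **The free massive Wilson operator on a vector: mass term plus first differences.**
`(D₁ v)(z,b,β) = m v(z,b,β) + ½ Σ_μ Σ_β' [(1−γ_μ)_{ββ'} (v(z,b,β') − v(z+μ̂,b,β')) + (1+γ_μ)_{ββ'} (v(z,b,β') − v(z−μ̂,b,β'))]`. -/
theorem wilsonDirac_freeCfg_mulVec_apply (m : ℝ) (v : TorusSite 4 L × Fin 3 × Fin 4 → ℂ)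
    (z : TorusSite 4 L) (b : Fin 3) (β : Fin 4) :
    (wilsonDirac (fundamentalRep (Fin 3)) (freeCfg L) m 1 *ᵥ v) (z, b, β) =
      ((m : ℝ) : ℂ) * v (z, b, β) + (1 / 2) * ∑ μ, ∑ β',
        ((1 - euclideanGamma μ) β β' * (v (z, b, β') - v (z + Pi.single μ 1, b, β')) +
          (1 + euclideanGamma μ) β β' * (v (z, b, β') - v (z - Pi.single μ 1, b, β'))) := by
  rw [wilsonDirac_freeCfg_eq_add_mass, Matrix.add_mulVec, Pi.add_apply, Matrix.smul_mulVec,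
    Matrix.one_mulVec, Pi.smul_apply, smul_eq_mul, wilsonDirac_one_mulVec_apply, add_comm]
  congr 1
  -- `4 v = ½ Σ_μ Σ_β' ((1-γ)+(1+γ))_{ββ'} v(β')`
  have hdiag : ∀ μ : Fin 4, ∑ β', ((1 - euclideanGamma μ) β β' + (1 + euclideanGamma μ) β β') * v (z, b, β') =
      2 * v (z, b, β) := by
    intro μ
    have : ∀ β', ((1 - euclideanGamma μ) β β' + (1 + euclideanGamma μ) β β') = 2 * (1 : Matrix (Fin 4) (Fin 4) ℂ) β β' := by
      intro β'
      rw [Matrix.sub_apply, Matrix.add_apply]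
      ring
    simp_rw [this, mul_assoc, ← Finset.mul_sum]
    congr 1
    rw [Finset.sum_eq_single β]
    · simp
    · intro β' _ hβ'; simp [Matrix.one_apply_ne (Ne.symm hβ')]
    · simp
  have h4 : (4 : ℂ) * v (z, b, β) = (1 / 2) * ∑ μ : Fin 4, ∑ β',
      ((1 - euclideanGamma μ) β β' + (1 + euclideanGamma μ) β β') * v (z, b, β') := by
    simp_rw [hdiag]
    simp
    ring
  rw [h4, ← mul_sub, ← Finset.sum_sub_distrib]
  congr 1
  refine Finset.sum_congr rfl fun μ _ => ?_
  rw [← Finset.sum_sub_distrib]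
  refine Finset.sum_congr rfl fun β' _ => ?_
  ring

/-- Entries of `1 ∓ γ_μ` (no scalar) have modulus at most `2`. -/
theorem norm_one_sub_euclideanGamma_apply_le (μ : Fin 4) (β β' : Fin 4) :
    ‖(1 - euclideanGamma μ) β β'‖ ≤ 2 ∧ ‖(1 + euclideanGamma μ) β β'‖ ≤ 2 := by
  have h1 : ‖(1 : Matrix (Fin 4) (Fin 4) ℂ) β β'‖ ≤ 1 := by
    rw [Matrix.one_apply]; split_ifs <;> simp
  have hγ := norm_euclideanGamma_apply_le μ β β'
  constructor
  · rw [Matrix.sub_apply]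
    exact (norm_sub_le _ _).trans (by linarith)
  · rw [Matrix.add_apply]
    exact (norm_add_le _ _).trans (by linarith)

/-- **Pointwise bound**: `|(D₁ v)(z,b,β)| ≤ |m| |v(z,b,β)| + Σ_μ Σ_β' (|v(z,b,β') − v(z+μ̂,b,β')| + |v(z,b,β') − v(z−μ̂,b,β')|)`. -/
theorem norm_wilsonDirac_freeCfg_mulVec_apply_le (m : ℝ) (v : TorusSite 4 L × Fin 3 × Fin 4 → ℂ)
    (z : TorusSite 4 L) (b : Fin 3) (β : Fin 4) :
    ‖(wilsonDirac (fundamentalRep (Fin 3)) (freeCfg L) m 1 *ᵥ v) (z, b, β)‖ ≤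
      |m| * ‖v (z, b, β)‖ + ∑ μ, ∑ β',
        (‖v (z, b, β') - v (z + Pi.single μ 1, b, β')‖ + ‖v (z, b, β') - v (z - Pi.single μ 1, b, β')‖) := by
  rw [wilsonDirac_freeCfg_mulVec_apply]
  refine (norm_add_le _ _).trans (add_le_add ?_ ?_)
  · rw [norm_mul, Complex.norm_real, Real.norm_eq_abs]
  · rw [norm_mul]
    have h12 : ‖(1 / 2 : ℂ)‖ = 1 / 2 := by simp
    rw [h12]
    have hsum : ‖∑ μ, ∑ β', ((1 - euclideanGamma μ) β β' * (v (z, b, β') - v (z + Pi.single μ 1, b, β')) +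
        (1 + euclideanGamma μ) β β' * (v (z, b, β') - v (z - Pi.single μ 1, b, β')))‖ ≤
        ∑ μ, ∑ β', (2 * ‖v (z, b, β') - v (z + Pi.single μ 1, b, β')‖ +
          2 * ‖v (z, b, β') - v (z - Pi.single μ 1, b, β')‖) := by
      refine (norm_sum_le _ _).trans (Finset.sum_le_sum fun μ _ => (norm_sum_le _ _).trans
        (Finset.sum_le_sum fun β' _ => (norm_add_le _ _).trans (add_le_add ?_ ?_)))
      · rw [norm_mul]
        exact mul_le_mul_of_nonneg_right (norm_one_sub_euclideanGamma_apply_le μ β β').1 (norm_nonneg _)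
      · rw [norm_mul]
        exact mul_le_mul_of_nonneg_right (norm_one_sub_euclideanGamma_apply_le μ β β').2 (norm_nonneg _)
    calc 1 / 2 * ‖_‖ ≤ 1 / 2 * ∑ μ, ∑ β', (2 * ‖v (z, b, β') - v (z + Pi.single μ 1, b, β')‖ +
          2 * ‖v (z, b, β') - v (z - Pi.single μ 1, b, β')‖) := by gcongr
      _ = _ := by
        rw [Finset.mul_sum]
        refine Finset.sum_congr rfl fun μ _ => ?_
        rw [Finset.mul_sum]
        refine Finset.sum_congr rfl fun β' _ => ?_
        ring

/-- Reindexing a backward difference sum into a forward one on the torus: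
`Σ_z |v(z) − v(z−μ̂)| = Σ_z |v(z+μ̂) − v(z)|` (sites shifted by the bijection `z ↦ z + μ̂`). -/
theorem sum_norm_sub_backward_eq (f : TorusSite 4 L → ℂ) (μ : Fin 4) :
    ∑ z : TorusSite 4 L, ‖f z - f (z - Pi.single μ 1)‖ =
      ∑ z : TorusSite 4 L, ‖f z - f (z + Pi.single μ 1)‖ := by
  refine (Fintype.sum_equiv (Equiv.addRight (Pi.single μ (1 : ZMod L)))
    (fun z' => ‖f z' - f (z' + Pi.single μ 1)‖) (fun z => ‖f z - f (z - Pi.single μ 1)‖) fun z' => ?_).symm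
  simp only [Equiv.coe_addRight, add_sub_cancel_right]
  rw [norm_sub_rev]

/-- **Summed bound**: `Σ_{z,b,β} |(D₁ v)(z,b,β)| ≤ |m| Σ_{z,b,β}|v(z,b,β)| + 8 Σ_μ Σ_{z,b,β'} |v(z,b,β') − v(z+μ̂,b,β')|`. -/
theorem sum_norm_wilsonDirac_freeCfg_mulVec_le (m : ℝ) (v : TorusSite 4 L × Fin 3 × Fin 4 → ℂ) :
    ∑ k, ‖(wilsonDirac (fundamentalRep (Fin 3)) (freeCfg L) m 1 *ᵥ v) k‖ ≤
      |m| * ∑ k, ‖v k‖ + 8 * ∑ μ : Fin 4, ∑ z : TorusSite 4 L, ∑ b : Fin 3, ∑ β' : Fin 4,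
        ‖v (z, b, β') - v (z + Pi.single μ 1, b, β')‖ := by
  -- abbreviate the forward / backward difference sums at fixed `(z,b)`
  set F : TorusSite 4 L → Fin 3 → Fin 4 → ℝ := fun z b μ =>
    ∑ β', ‖v (z, b, β') - v (z + Pi.single μ 1, b, β')‖ with hF
  set Bk : TorusSite 4 L → Fin 3 → Fin 4 → ℝ := fun z b μ =>
    ∑ β', ‖v (z, b, β') - v (z - Pi.single μ 1, b, β')‖ with hBk
  have hpt : ∀ z b β, ‖(wilsonDirac (fundamentalRep (Fin 3)) (freeCfg L) m 1 *ᵥ v) (z, b, β)‖ ≤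
      |m| * ‖v (z, b, β)‖ + ∑ μ, (F z b μ + Bk z b μ) := by
    intro z b β
    refine (norm_wilsonDirac_freeCfg_mulVec_apply_le m v z b β).trans (le_of_eq ?_)
    congr 1
    refine Finset.sum_congr rfl fun μ _ => ?_
    rw [hF, hBk, ← Finset.sum_add_distrib]
  -- backward sums equal forward sums after summing over the sites
  have hback : ∀ (μ : Fin 4) (b : Fin 3), ∑ z, Bk z b μ = ∑ z, F z b μ := by
    intro μ b
    simp only [hF, hBk]
    rw [Finset.sum_comm]
    conv_rhs => rw [Finset.sum_comm]
    refine Finset.sum_congr rfl fun β' _ => ?_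
    exact sum_norm_sub_backward_eq (fun z => v (z, b, β')) μ
  have hsplit : ∑ z, ∑ b, ∑ β : Fin 4, (|m| * ‖v (z, b, β)‖ + ∑ μ, (F z b μ + Bk z b μ)) =
      |m| * ∑ k, ‖v k‖ + ((4 * ∑ z, ∑ b, ∑ μ, F z b μ) + 4 * ∑ z, ∑ b, ∑ μ, Bk z b μ) := by
    have e1 : ∀ z b, ∑ β : Fin 4, (|m| * ‖v (z, b, β)‖ + ∑ μ, (F z b μ + Bk z b μ)) =
        |m| * ∑ β, ‖v (z, b, β)‖ + ((4 * ∑ μ, F z b μ) + 4 * ∑ μ, Bk z b μ) := by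
      intro z b
      rw [Finset.sum_add_distrib, Finset.sum_const, Finset.card_univ, Fintype.card_fin, ← Finset.mul_sum,
        nsmul_eq_mul, Nat.cast_ofNat, Finset.sum_add_distrib, mul_add]
    simp_rw [e1]
    simp only [Finset.sum_add_distrib, Finset.mul_sum, Fintype.sum_prod_type]
  have hBk_eq : ∑ z, ∑ b, ∑ μ, Bk z b μ = ∑ z, ∑ b, ∑ μ, F z b μ := by
    rw [Finset.sum_comm]
    conv_rhs => rw [Finset.sum_comm]
    refine Finset.sum_congr rfl fun b _ => ?_
    rw [Finset.sum_comm]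
    conv_rhs => rw [Finset.sum_comm]
    exact Finset.sum_congr rfl fun μ _ => hback μ b
  have hF_comm : ∑ z, ∑ b, ∑ μ, F z b μ = ∑ μ : Fin 4, ∑ z : TorusSite 4 L, ∑ b : Fin 3, F z b μ := by
    have : ∀ z, ∑ b : Fin 3, ∑ μ : Fin 4, F z b μ = ∑ μ, ∑ b, F z b μ := fun z => Finset.sum_comm
    simp_rw [this]
    exact Finset.sum_comm
  calc ∑ k, ‖(wilsonDirac (fundamentalRep (Fin 3)) (freeCfg L) m 1 *ᵥ v) k‖
      = ∑ z, ∑ b, ∑ β, ‖(wilsonDirac (fundamentalRep (Fin 3)) (freeCfg L) m 1 *ᵥ v) (z, b, β)‖ := by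
        simp only [Fintype.sum_prod_type]
    _ ≤ ∑ z, ∑ b, ∑ β : Fin 4, (|m| * ‖v (z, b, β)‖ + ∑ μ, (F z b μ + Bk z b μ)) :=
        Finset.sum_le_sum fun z _ => Finset.sum_le_sum fun b _ => Finset.sum_le_sum fun β _ => hpt z b β
    _ = |m| * ∑ k, ‖v k‖ + 8 * ∑ μ : Fin 4, ∑ z : TorusSite 4 L, ∑ b : Fin 3, F z b μ := by
        rw [hsplit, hBk_eq, hF_comm]
        ring

/-! ### The smoothing row bound -/

/-- Reindexing a shifted site sum: `Σ_z g(z + μ̂) = Σ_z g(z)`. -/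
theorem sum_shift_eq (g : TorusSite 4 L → ℝ) (μ : Fin 4) :
    ∑ z : TorusSite 4 L, g (z + Pi.single μ 1) = ∑ z : TorusSite 4 L, g z :=
  Fintype.sum_equiv (Equiv.addRight (Pi.single μ (1 : ZMod L))) _ _ fun _ => rfl

/-- **The smoothing row in `ℓ¹`.**  For ANY matrix `K` on site × colour × spin, any site cutoff `χ`
with values in `[0,1]` that is `16/N`-Lipschitz under unit moves, and the free massive Wilson operator
`D₁`: `Σ_k |(K M_χ D₁ᴴ)(i,k)| ≤ |m| R₁ + 32 A + 512 R₁/N`, where `R₁` bounds the row `ℓ¹` norm of `K`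
at `i` and `A` bounds each of its four summed nearest-neighbour column differences. -/
theorem sum_norm_mul_cutoff_mul_conjTranspose_le (K : Matrix (TorusSite 4 L × Fin 3 × Fin 4)
    (TorusSite 4 L × Fin 3 × Fin 4) ℂ) (χ : TorusSite 4 L → ℝ) (i : TorusSite 4 L × Fin 3 × Fin 4)
    {N : ℕ} (hN : 1 ≤ N) (m : ℝ)
    (hχ01 : ∀ z, 0 ≤ χ z ∧ χ z ≤ 1) (hχlip : ∀ z z', torusDist z z' ≤ 1 → |χ z - χ z'| ≤ 16 / (N : ℝ))
    {R₁ A : ℝ} (hR : ∑ j, ‖K i j‖ ≤ R₁)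
    (hA : ∀ μ : Fin 4, ∑ z : TorusSite 4 L, ∑ b : Fin 3, ∑ β : Fin 4,
      ‖K i (z, b, β) - K i (Site.shift z μ, b, β)‖ ≤ A) :
    ∑ k, ‖(K * Matrix.diagonal (fun j : TorusSite 4 L × Fin 3 × Fin 4 => ((χ j.1 : ℝ) : ℂ)) *
        (wilsonDirac (fundamentalRep (Fin 3)) (freeCfg L) m 1)ᴴ) i k‖ ≤
      |m| * R₁ + 32 * A + 512 * R₁ / (N : ℝ) := by
  have hNpos : (0 : ℝ) < N := by exact_mod_cast hN
  set w : TorusSite 4 L × Fin 3 × Fin 4 → ℂ := fun q =>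
    conj ((K * Matrix.diagonal (fun j : TorusSite 4 L × Fin 3 × Fin 4 => ((χ j.1 : ℝ) : ℂ))) i q) with hw
  have hwq : ∀ q, w q = conj (K i q * ((χ q.1 : ℝ) : ℂ)) := fun q => by
    simp only [hw, Matrix.mul_diagonal]
  have hnormw : ∀ q, ‖w q‖ = ‖K i q‖ * χ q.1 := fun q => by
    rw [hwq, Complex.norm_conj, norm_mul, Complex.norm_real, Real.norm_eq_abs, abs_of_nonneg (hχ01 q.1).1]
  -- rewrite the row as `D₁` applied to `w`
  have hrow : ∀ k, ‖(K * Matrix.diagonal (fun j : TorusSite 4 L × Fin 3 × Fin 4 => ((χ j.1 : ℝ) : ℂ)) *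
      (wilsonDirac (fundamentalRep (Fin 3)) (freeCfg L) m 1)ᴴ) i k‖ =
      ‖(wilsonDirac (fundamentalRep (Fin 3)) (freeCfg L) m 1 *ᵥ w) k‖ := fun k => by
    rw [mul_conjTranspose_apply_eq_conj_mulVec, Complex.norm_conj]
  simp_rw [hrow]
  refine (sum_norm_wilsonDirac_freeCfg_mulVec_le m w).trans ?_
  -- the mass part
  have h1 : ∑ k, ‖w k‖ ≤ R₁ := by
    refine le_trans (Finset.sum_le_sum fun k _ => ?_) hR
    rw [hnormw]
    exact mul_le_of_le_one_right (norm_nonneg _) (hχ01 k.1).2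
  -- the difference part, direction by direction
  have h2 : ∀ μ : Fin 4, ∑ z : TorusSite 4 L, ∑ b : Fin 3, ∑ β' : Fin 4,
      ‖w (z, b, β') - w (z + Pi.single μ 1, b, β')‖ ≤ A + 16 * R₁ / (N : ℝ) := by
    intro μ
    have hpt : ∀ z b β', ‖w (z, b, β') - w (z + Pi.single μ 1, b, β')‖ ≤
        ‖K i (z, b, β') - K i (Site.shift z μ, b, β')‖ + ‖K i (z + Pi.single μ 1, b, β')‖ * (16 / (N : ℝ)) := by
      intro z b β'
      have hshift : Site.shift z μ = z + Pi.single μ 1 := rfl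
      rw [hwq, hwq, ← map_sub, Complex.norm_conj, hshift]
      have hsplit : K i (z, b, β') * ((χ z : ℝ) : ℂ) - K i (z + Pi.single μ 1, b, β') * ((χ (z + Pi.single μ 1) : ℝ) : ℂ)
          = (K i (z, b, β') - K i (z + Pi.single μ 1, b, β')) * ((χ z : ℝ) : ℂ) +
            K i (z + Pi.single μ 1, b, β') * (((χ z : ℝ) : ℂ) - ((χ (z + Pi.single μ 1) : ℝ) : ℂ)) := by ring
      rw [hsplit]
      refine (norm_add_le _ _).trans (add_le_add ?_ ?_)
      · rw [norm_mul, Complex.norm_real, Real.norm_eq_abs, abs_of_nonneg (hχ01 z).1]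
        exact mul_le_of_le_one_right (norm_nonneg _) (hχ01 z).2
      · rw [norm_mul, ← Complex.ofReal_sub, Complex.norm_real, Real.norm_eq_abs]
        refine mul_le_mul_of_nonneg_left (hχlip z _ ?_) (norm_nonneg _)
        exact Summit.QuantumFields.QCD.Theorems.HeatSlicedQuarksDaviesGaffney.torusDist_self_shift_le z μ
    calc ∑ z : TorusSite 4 L, ∑ b : Fin 3, ∑ β' : Fin 4, ‖w (z, b, β') - w (z + Pi.single μ 1, b, β')‖
        ≤ ∑ z : TorusSite 4 L, ∑ b : Fin 3, ∑ β' : Fin 4,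
            (‖K i (z, b, β') - K i (Site.shift z μ, b, β')‖ + ‖K i (z + Pi.single μ 1, b, β')‖ * (16 / (N : ℝ))) :=
          Finset.sum_le_sum fun z _ => Finset.sum_le_sum fun b _ => Finset.sum_le_sum fun β' _ => hpt z b β'
      _ = (∑ z : TorusSite 4 L, ∑ b : Fin 3, ∑ β' : Fin 4, ‖K i (z, b, β') - K i (Site.shift z μ, b, β')‖) +
            (∑ z : TorusSite 4 L, ∑ b : Fin 3, ∑ β' : Fin 4, ‖K i (z + Pi.single μ 1, b, β')‖) * (16 / (N : ℝ)) := by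
          simp only [Finset.sum_add_distrib, Finset.sum_mul]
      _ ≤ A + R₁ * (16 / (N : ℝ)) := by
          refine add_le_add (hA μ) (mul_le_mul_of_nonneg_right ?_ (by positivity))
          have hre : ∑ z : TorusSite 4 L, ∑ b : Fin 3, ∑ β' : Fin 4, ‖K i (z + Pi.single μ 1, b, β')‖ =
              ∑ j, ‖K i j‖ := by
            rw [sum_shift_eq (fun z => ∑ b : Fin 3, ∑ β' : Fin 4, ‖K i (z, b, β')‖) μ]
            simp only [Fintype.sum_prod_type]
          rw [hre]
          exact hR
      _ = A + 16 * R₁ / (N : ℝ) := by ring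
  have h3 : ∑ μ : Fin 4, ∑ z : TorusSite 4 L, ∑ b : Fin 3, ∑ β' : Fin 4,
      ‖w (z, b, β') - w (z + Pi.single μ 1, b, β')‖ ≤ 4 * (A + 16 * R₁ / (N : ℝ)) := by
    calc _ ≤ ∑ μ : Fin 4, (A + 16 * R₁ / (N : ℝ)) := Finset.sum_le_sum fun μ _ => h2 μ
      _ = 4 * (A + 16 * R₁ / (N : ℝ)) := by simp; ring
  have hm0 : 0 ≤ |m| := abs_nonneg m
  calc |m| * ∑ k, ‖w k‖ + 8 * ∑ μ : Fin 4, ∑ z : TorusSite 4 L, ∑ b : Fin 3, ∑ β' : Fin 4,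
        ‖w (z, b, β') - w (z + Pi.single μ 1, b, β')‖
      ≤ |m| * R₁ + 8 * (4 * (A + 16 * R₁ / (N : ℝ))) := by gcongr
    _ = |m| * R₁ + 32 * A + 512 * R₁ / (N : ℝ) := by ring

/-- **Registered form (stub `stub_smoothingRow` of the crux item)**: the `ℓ¹` bound of the smoothing
row `K M_χ D₁ᴴ` of the free parametrix (`sum_norm_mul_cutoff_mul_conjTranspose_le`). -/
theorem stub_smoothingRow :
    ∀ (L : ℕ) [NeZero L] (K : Matrix (TorusSite 4 L × Fin 3 × Fin 4) (TorusSite 4 L × Fin 3 × Fin 4) ℂ)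
      (χ : TorusSite 4 L → ℝ) (i : TorusSite 4 L × Fin 3 × Fin 4) (N : ℕ) (m R₁ A : ℝ), 1 ≤ N →
      (∀ z, 0 ≤ χ z ∧ χ z ≤ 1) → (∀ z z', torusDist z z' ≤ 1 → |χ z - χ z'| ≤ 16 / (N : ℝ)) →
      ∑ j, ‖K i j‖ ≤ R₁ →
      (∀ μ : Fin 4, ∑ z : TorusSite 4 L, ∑ b : Fin 3, ∑ β : Fin 4,
        ‖K i (z, b, β) - K i (Site.shift z μ, b, β)‖ ≤ A) →
      ∑ k, ‖(K * Matrix.diagonal (fun j : TorusSite 4 L × Fin 3 × Fin 4 => ((χ j.1 : ℝ) : ℂ)) *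
          (wilsonDirac (fundamentalRep (Fin 3)) (freeCfg L) m 1)ᴴ) i k‖ ≤
        |m| * R₁ + 32 * A + 512 * R₁ / (N : ℝ) :=
  fun _ _ K χ i _ m _ _ hN hχ01 hχlip hR hA =>
    sum_norm_mul_cutoff_mul_conjTranspose_le K χ i hN m hχ01 hχlip hR hA

end Summit.QuantumFields.QCD.Cruxes.SmallFieldUltracontractivity.PointCentredAxialParabolic

end
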